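import Summits.BirchSwinnertonDyer.BirchSwinnertonDyer.Theorems.KolyvaginDepthDoorKolyvaginDepthSupplyDoorOfDatum
import Summits.BirchSwinnertonDyer.BirchSwinnertonDyer.Theorems.KolyvaginDepthDoorKolyvaginDepthSupplyLeafSign
import Summits.BirchSwinnertonDyer.BirchSwinnertonDyer.Theorems.KolyvaginDepthDoorKolyvaginDepthSupplyLeafEigenLine
import Summits.BirchSwinnertonDyer.BirchSwinnertonDyer.Theorems.KolyvaginDepthDoorKolyvaginDepthSupplyLeafLocal
import Summits.BirchSwinnertonDyer.BirchSwinnertonDyer.Theorems.KolyvaginDepthDoorKolyvaginDepthSupplyLeafReciprocity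
import Summits.BirchSwinnertonDyer.Rank1Residual.JET.McCallumProp44ByName
import HarnessLib

/-!
# Route `KolyvaginDepthDoor`, crux `KolyvaginDepthSupply` (stmt-BirchSwinnertonDyer-21765) —
# THE DOOR OF A DATUM ON PRINT-STANDARD INPUTS: the five McCallum leaves of `…DoorOfDatum` REPLACED by
# {nothing, nothing, nothing} + the Eichler–Shimura congruence (γ) [Gross 1991 Prop. 3.7 (2)] +
# {the Kodaira–Néron side condition (KN_p) | [GZ86 III (3.1)]}

Helper file (`--supports stmt-BirchSwinnertonDyer-21765 --as helper`); it closes nothing and BSD is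
not proved by it.

`…KolyvaginDepthSupplyDoorOfDatum.shaCorank_eq_zero_of_kolyvaginClass_ne_zero_of_rank_le_of_datum`
(g7) reads `corank_{ℤ_p} Ш(E/ℚ)[p^∞] = 0`, `rank E(ℚ) = ν + 1`, … off ONE datum with `c_1(n₁) ≠ 0` and
`ν + 1 ≤ rank E(ℚ)`, GRANTED five named McCallum / Gross leaves (file
`McCallum1991/KolyvaginClassesLocalLeaves`, "no `_holds`"): `h54` sign law, `h43` Lemma 4.3, `h44`
Prop. 4.4, `h53` Lemma 5.3, `h22` Prop. 2.2. This file re-runs that door with, at level `p`: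

* `h54` ← `sign_conjAct_kolyvaginClass_holds` (PROVED, `…LeafSign`; JET cell's Gross 5.4 (1));
* `h43` ← `kolyvaginClass_mem_selmerLocalKer_infinitePlace` (PROVED) and
  `kolyvaginClass_mem_selmerLocalKer_finite_one_of_kodairaNeron` (PROVED on (KN_p)) /
  `…_of_gross1991E0` (from the Literature fact [GZ86 III (3.1)]) (`…LeafLocal`; x11b3's ENDs);
* `h44` ← `JET.prop44_of_frobeniusCongruence h372` — McCallum Prop. 4.4 DERIVED by cell `bsd-jet` from
  the image-free Literature fact (γ) `GrossLMS1991.prop37_2_frobeniusCongruence` (Gross 1991 Prop. 3.7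
  (2): `y_{mℓ} ≡ Frob · y_m` at the primes over `ℓ` — the Eichler–Shimura congruence; cite-only);
* `h53` ← `lemma53_selmer_eigen_dependent_at_one` (PROVED, `…LeafEigenLine`);
* `h22` ← `prop22_reciprocity_eigen_finset_one` (PROVED, `…LeafReciprocity`; Poitou–Tate is the
  tree theorem `poitouTate_sum_localTatePairing_eq_zero_holds`).

* `shaCorank_eq_zero_of_kolyvaginClass_ne_zero_of_rank_le_of_datum_kodairaNeron` — **THE DOOR OF A
  DATUM ON (KN_p)**: hypotheses = (γ) + (KN_p) (`p ∤ ord_v Δ_min` at multiplicative `v`; at `p = 3`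
  no IV/IV*) + the datum with `c_1(n₁) ≠ 0` + `ν + 1 ≤ rank E(ℚ)`; conclusions verbatim g7's.
* `shaCorank_eq_zero_of_kolyvaginClass_ne_zero_of_rank_le_of_datum_gross1991E0` — **THE DOOR OF A
  DATUM IN GENERAL**: hypotheses = (γ) + [GZ86 III (3.1)] (`Gross1991_heegnerPoint_sub_ratTorsion_mem_E0`)
  + datum + rank.
* `…_of_two_le_rank_…_kodairaNeron` / `…_gross1991E0` — the rank-2 slice / depth-table row of a datum.

NET TRADE per door / row vs g7: FIVE route-specific S/M named leaves ↦ ONE standard published theorem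
as a Literature `def` ((γ), shared with the JET / x11b3 programmes) [+ one more, [GZ86 III (3.1)], off
the Kodaira–Néron cell]. Per-curve; conditional on (γ) [and F1 off (KN_p)]; BSD is not proved by it.

References: [GrossLMS1991] Prop. 3.7 (2), Props. 5.4, 6.2, 8.1, 8.2, §10; [McCallumLMS1991] Prop. 2.2,
Cor. 3.2, Lemma 4.3, Prop. 4.4, Lemma 5.3; [Kolyvagin1991MathAnn] Thm. 2.3; [GrossZagier1986] III (3.1);
[Nekovar2007] Prop. 4.9, 4.13 (ii); [WZhang2014] Notations (xii); [JetchevLauterStein2009] §3.6.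
-/

set_option linter.dupNamespace false

noncomputable section

open scoped Classical

namespace Summit.BirchSwinnertonDyer.BirchSwinnertonDyer.Theorems.KolyvaginDepthDoor

open Literature.NumberTheory.EllipticCurves Literature.NumberTheory.EllipticCurves.ModularForms
  Literature.NumberTheory.EllipticCurves.KolyvaginDescent
  Literature.NumberTheory.EllipticCurves.McCallum1991 WeierstrassCurve NumberField IsDedekindDomain
open Literature.NumberTheory.DiophantineGeometry (KodairaSymbol)

section Datum

variable {W : WeierstrassCurve ℚ} [W.IsElliptic] [W.IsGloballyMinimal] [NeZero (W.conductorNorm ℤ)]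
  {K : Type} [Field K] [NumberField K]
  {Dt : ModularParametrizationData W (W.conductorNorm ℤ)} {β : ℤ} {ι : K →+* ℂ}

/-- **The door of a datum with the local-triviality clause `hfin` as its ONLY remaining local input**
(internal form shared by the two public doors below): g7's
`shaCorank_eq_zero_of_kolyvaginClass_ne_zero_of_rank_le_of_datum` re-run with `h54`, `h53`, `h22`
DISCHARGED (`sign_conjAct_kolyvaginClass_holds`, `lemma53_selmer_eigen_dependent_at_one`,
`prop22_reciprocity_eigen_finset_one`), the archimedean half of `h43` discharged
(`kolyvaginClass_mem_selmerLocalKer_infinitePlace`), `h44` from (γ) via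
`JET.prop44_of_frobeniusCongruence`, and the finite half of `h43` kept as the displayed hypothesis
`hfin` (per datum of the compatible system through `d₁`, level `p`). [cite: Kolyvagin1991MathAnn, Thm. 2.3]
[cite: McCallumLMS1991, §§2–5] [cite: GrossLMS1991, Prop. 3.7 (2), §10] -/
theorem shaCorank_eq_zero_of_kolyvaginClass_ne_zero_of_rank_le_of_datum_of_hfin
    (h372 : GrossLMS1991.prop37_2_frobeniusCongruence)
    (hcm : ¬ W.HasCM) (hK : IsImaginaryQuadratic K) (hD3 : NumberField.discr K ≠ -3)
    (hD4 : NumberField.discr K ≠ -4) (hH : SatisfiesHeegnerHypothesis (W.conductorNorm ℤ) K)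
    (p : ℕ) [hp : Fact p.Prime] (hp2 : p ≠ 2)
    (htower : ∀ n : ℕ, W.HasSurjectiveModNGaloisRep (p ^ n : ℕ))
    (c : K ≃ₐ[ℚ] K) (hc : c ≠ 1) (hcc : c * c = 1)
    (hfin : ∀ (n : ℕ), Squarefree n →
      (∀ q ∈ n.primeFactors, Zhang2014.IsKolyvaginPrime (W.conductorNorm ℤ) W K p q) →
      ∀ (d : KolyvaginHeegnerData Dt β ι n) (v : HeightOneSpectrum (𝓞 K)), (n : 𝓞 K) ∉ v.asIdeal →
        d.kolyvaginClass hp.out 1 ∈ selmerLocalKer (W.baseChange K) (v.adicCompletion K) ((p ^ 1 : ℕ) : ℤ))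
    {n₁ : ℕ} (hn₁ : Squarefree n₁)
    (hk₁ : ∀ q ∈ n₁.primeFactors, Zhang2014.IsKolyvaginPrime (W.conductorNorm ℤ) W K p q)
    (d₁ : KolyvaginHeegnerData Dt β ι n₁) (hne : d₁.kolyvaginClass hp.out 1 ≠ 0)
    (hrank : n₁.primeFactors.card + 1 ≤ W.mordellWeilRank) :
    W.shaCorank p = 0 ∧ W.mordellWeilRank = n₁.primeFactors.card + 1 ∧
      (W.quadraticTwist (NumberField.discr K : ℚ)).mordellWeilRank ≤ n₁.primeFactors.card ∧
      Nat.card ↥(AddSubgroup.torsionBy W.toAffine.Point ((p ^ 1 : ℕ) : ℤ)) = 1 ∧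
      W.sha ⊓ AddSubgroup.torsionBy W.galH1 ((p ^ 1 : ℕ) : ℤ) = ⊥ ∧
      Nat.card ↥(selmerGroup W ((p ^ 1 : ℕ) : ℤ)) = p ^ (n₁.primeFactors.card + 1) := by
  have hρ : W.HasSurjectiveModNGaloisRep p := by simpa only [pow_one] using htower 1
  have h44 : prop44_localOrder_kolyvaginClass_mul_eq :=
    Summit.BirchSwinnertonDyer.Rank1Residual.JET.prop44_of_frobeniusCongruence h372
  -- `ℓ' ∈ S₁(1)` for every Kolyvagin prime (Zhang's `0 < M(ℓ')`), and Kolyvagin primes are inert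
  have hS1 : ∀ {n : ℕ}, (∀ q ∈ n.primeFactors, Zhang2014.IsKolyvaginPrime (W.conductorNorm ℤ) W K p q) →
      ∀ q ∈ n.primeFactors, Zhang2014.IsKolyvaginPrime (W.conductorNorm ℤ) W K p q ∧
        1 ≤ Zhang2014.kolyvaginIndex W p q :=
    fun h q hq ↦ ⟨h q hq, (h q hq).2.2.2.2.2⟩
  have hinert : ∀ {n : ℕ},
      (∀ q ∈ n.primeFactors, Zhang2014.IsKolyvaginPrime (W.conductorNorm ℤ) W K p q) →
      ∀ q ∈ n.primeFactors, (Ideal.span {(q : 𝓞 K)}).IsPrime :=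
    fun h q hq ↦ (h q hq).2.2.2.2.1
  have hd4 : NumberField.discr K < -4 := discr_lt_neg_four_of_frame hK hD3 hD4 d₁.dvd_sq_sub
  -- the compatible system through `d₁`
  obtain ⟨d, hd₁, hcoh⟩ :=
    exists_kolyvaginHeegnerSystem_extending hK hd4 hH Dt β ι hn₁ (hinert hk₁) d₁
  -- its class family (junk `0` off the good levels)
  let cl : ℕ → galH1Torsion (W.baseChange K) ((p ^ 1 : ℕ) : ℤ) := fun n ↦
    if h : Squarefree n ∧ ∀ q ∈ n.primeFactors, (Ideal.span {(q : 𝓞 K)}).IsPrime then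
      (d n h.1 h.2).kolyvaginClass hp.out 1 else 0
  have hcl : ∀ (n : ℕ) (hn : Squarefree n)
      (hin : ∀ q ∈ n.primeFactors, (Ideal.span {(q : 𝓞 K)}).IsPrime),
      cl n = (d n hn hin).kolyvaginClass hp.out 1 := fun n hn hin ↦ by
    simp only [cl, dif_pos (show Squarefree n ∧ _ from ⟨hn, hin⟩)]
  -- the sign law (Gross Prop. 5.4 (2)) — PROVED (`…LeafSign`)
  obtain ⟨ε, hε, hsign⟩ :=
    sign_conjAct_kolyvaginClass_holds W hcm K hK hD3 hD4 hH p hp2 htower c hc Dt β ι 1 le_rfl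
  -- `h44`: McCallum Prop. 4.4 "in particular" for the compatible pairs `(d m, d (m l))`, from (γ)
  have hh44 : ∀ (l m : ℕ), Squarefree (l * m) →
      (∀ q ∈ (l * m).primeFactors, Zhang2014.IsKolyvaginPrime (W.conductorNorm ℤ) W K p q) →
      Zhang2014.IsKolyvaginPrime (W.conductorNorm ℤ) W K p l →
      ∀ v : HeightOneSpectrum (𝓞 K), (l : 𝓞 K) ∈ v.asIdeal →
        (cl (l * m) ∈ selmerLocalKer (W.baseChange K) (v.adicCompletion K) ((p ^ 1 : ℕ) : ℤ) ↔
          cl m ∈ (W.baseChange K).torsionLocalKer (v.adicCompletion K) ((p ^ 1 : ℕ) : ℤ)) := by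
    intro l m hsq hk hl v hv
    have hsq' : Squarefree (m * l) := by rwa [Nat.mul_comm] at hsq
    have hk' : ∀ q ∈ (m * l).primeFactors, Zhang2014.IsKolyvaginPrime (W.conductorNorm ℤ) W K p q ∧
        1 ≤ Zhang2014.kolyvaginIndex W p q := by
      rw [Nat.mul_comm]
      exact hS1 hk
    have hkml : ∀ q ∈ (m * l).primeFactors, Zhang2014.IsKolyvaginPrime (W.conductorNorm ℤ) W K p q :=
      fun q hq ↦ (hk' q hq).1
    have hm : Squarefree m := hsq'.squarefree_of_dvd (dvd_mul_right m l)
    have hkm : ∀ q ∈ m.primeFactors, Zhang2014.IsKolyvaginPrime (W.conductorNorm ℤ) W K p q :=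
      fun q hq ↦ hkml q (Nat.mem_primeFactors.mpr ⟨Nat.prime_of_mem_primeFactors hq,
        (Nat.dvd_of_mem_primeFactors hq).trans (dvd_mul_right m l), hsq'.ne_zero⟩)
    have hlm : ¬ l ∣ m := by
      intro hdiv
      have hll : l * l ∣ l * m := Nat.mul_dvd_mul_left l hdiv
      exact hl.1.not_isUnit (hsq l hll)
    obtain ⟨hσ, hS₁, hS₂, hemb⟩ :=
      hcoh m (m * l) hm (hinert hkm) hsq' (hinert hkml) (dvd_mul_right m l)
    have hA := kolyvaginClass_mul_mem_selmerLocalKer_iff_of_prop44 h44 W hcm K hK hD3 hD4 hH p hp2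
      htower Dt β ι 1 le_rfl m l hsq' hl.1 hlm hk' (d m hm (hinert hkm)) (d (m * l) hsq' (hinert hkml))
      hσ hS₁ hS₂ hemb v hv
    have hB := kolyvaginClass_mul_mem_torsionLocalKer_iff_of_prop44 h44 W hcm K hK hD3 hD4 hH p hp2
      htower Dt β ι 1 le_rfl m l hsq' hl.1 hlm hk' (d m hm (hinert hkm)) (d (m * l) hsq' (hinert hkml))
      hσ hS₁ hS₂ hemb v hv
    rw [Nat.mul_comm l m, hcl (m * l) hsq' (hinert hkml), hcl m hm (hinert hkm)]
    exact hA.trans hB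
  obtain ⟨S, hSel, hSp, hSc, hSK, hSτ⟩ := exists_hypothesesDepth_of_classes hcm hK p hp2 htower c hc
    hcc cl ε hε
    (fun n hn hk ↦ by rw [hcl n hn (hinert hk)]; exact hsign n hn (hS1 hk) _)
    (fun n hn hk v hv ↦ by
      rw [hcl n hn (hinert hk)]
      exact hfin n hn hk _ v hv)
    (fun n hn hk w ↦ by
      rw [hcl n hn (hinert hk)]
      exact kolyvaginClass_mem_selmerLocalKer_infinitePlace hK _ hp.out 1 w)
    hh44
    (fun l hl e he s₁ hs₁ hτ₁ s₂ hs₂ hτ₂ ↦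
      lemma53_selmer_eigen_dependent_at_one W Dt hK p hp2 htower c hc l hl e he s₁ hs₁ hτ₁ s₂ hs₂ hτ₂)
    (fun T hT l hlT e he x hx hoff hinf s hs hτs hsT v hv hsv ↦
      prop22_reciprocity_eigen_finset_one W Dt hK hp2 hρ hc T hT hlT he x hx hoff hinf s hs hτs hsT
        v hv hsv)
  have hsupp : KolSupp S.Kol n₁ := by rw [hSK]; exact ⟨hn₁, hk₁⟩
  have hne' : S.c n₁ ≠ 0 := by rw [hSc, hcl n₁ hn₁ (hinert hk₁), hd₁]; exact hne
  exact door_of_hypothesesDepth W K hK.1 c hc p hp2 (pow_one p) S hSel hSp hSτ hsupp hne' hrank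

/-- **THE DOOR OF A DATUM ON THE KODAIRA–NÉRON CELL (any depth; hF-free, twist-free, system-free,
McCallum-leaf-free).** `E/ℚ` globally minimal without CM, `K` imaginary quadratic with
`d_K ∉ {−3, −4}` and the Heegner hypothesis for `N_E`, `c` its complex conjugation, `p` odd with
`ρ̄_{E,p^n}` onto for all `n`, a frame `(Dt, β, ι)`; (KN_p): `p ∤ ord_v(Δ_min)` at every multiplicative
place of `E/ℚ` and — only when `p = 3` — no additive place of type IV / IV*; and the ONE named input
(γ) = `GrossLMS1991.prop37_2_frobeniusCongruence` (Gross 1991 Prop. 3.7 (2), the Eichler–Shimura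
congruence for Heegner points of consecutive conductors; cite-only). If ONE datum `d₁` of square-free
conductor `n₁` with `ν` Zhang–Kolyvagin prime factors has `c_1(n₁) ≠ 0`, and `ν + 1 ≤ rank E(ℚ)`,
then `corank_{ℤ_p} Ш(E/ℚ)[p^∞] = 0`, `rank E(ℚ) = ν + 1`, `rank E^{(d_K)}(ℚ) ≤ ν`, `#E(ℚ)[p] = 1`,
`Ш(E/ℚ)[p] = 0`, `#Sel_p(E/ℚ) = p^{ν+1}`. CONDITIONAL on (γ) only; per-curve; BSD is not proved by it.
[cite: Kolyvagin1991MathAnn, Thm. 2.3] [cite: GrossLMS1991, Prop. 3.7 (2), Props. 5.4, 6.2, 8.1, 8.2, §10]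
[cite: McCallumLMS1991, §§2–5] [cite: SilvermanAEC2009, VII.6.1] -/
theorem shaCorank_eq_zero_of_kolyvaginClass_ne_zero_of_rank_le_of_datum_kodairaNeron
    (h372 : GrossLMS1991.prop37_2_frobeniusCongruence)
    (hcm : ¬ W.HasCM) (hK : IsImaginaryQuadratic K) (hD3 : NumberField.discr K ≠ -3)
    (hD4 : NumberField.discr K ≠ -4) (hH : SatisfiesHeegnerHypothesis (W.conductorNorm ℤ) K)
    (p : ℕ) [hp : Fact p.Prime] (hp2 : p ≠ 2)
    (htower : ∀ n : ℕ, W.HasSurjectiveModNGaloisRep (p ^ n : ℕ))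
    (c : K ≃ₐ[ℚ] K) (hc : c ≠ 1) (hcc : c * c = 1)
    (hmult : ∀ v : HeightOneSpectrum (𝓞 ℚ), W.HasMultiplicativeReductionAt v →
      ¬ p ∣ W.ordMinimalDiscriminant v)
    (hadd : ∀ v : HeightOneSpectrum (𝓞 ℚ), W.HasAdditiveReductionAt v → p ≠ 3 ∨
      (W.kodairaSymbolAt v ≠ KodairaSymbol.IV ∧ W.kodairaSymbolAt v ≠ KodairaSymbol.IVstar))
    {n₁ : ℕ} (hn₁ : Squarefree n₁)
    (hk₁ : ∀ q ∈ n₁.primeFactors, Zhang2014.IsKolyvaginPrime (W.conductorNorm ℤ) W K p q)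
    (d₁ : KolyvaginHeegnerData Dt β ι n₁) (hne : d₁.kolyvaginClass hp.out 1 ≠ 0)
    (hrank : n₁.primeFactors.card + 1 ≤ W.mordellWeilRank) :
    W.shaCorank p = 0 ∧ W.mordellWeilRank = n₁.primeFactors.card + 1 ∧
      (W.quadraticTwist (NumberField.discr K : ℚ)).mordellWeilRank ≤ n₁.primeFactors.card ∧
      Nat.card ↥(AddSubgroup.torsionBy W.toAffine.Point ((p ^ 1 : ℕ) : ℤ)) = 1 ∧
      W.sha ⊓ AddSubgroup.torsionBy W.galH1 ((p ^ 1 : ℕ) : ℤ) = ⊥ ∧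
      Nat.card ↥(selmerGroup W ((p ^ 1 : ℕ) : ℤ)) = p ^ (n₁.primeFactors.card + 1) :=
  shaCorank_eq_zero_of_kolyvaginClass_ne_zero_of_rank_le_of_datum_of_hfin h372 hcm hK hD3 hD4 hH p hp2
    htower c hc hcc
    (fun _n hn hk d v hv ↦ kolyvaginClass_mem_selmerLocalKer_finite_one_of_kodairaNeron hK hD3 hD4 hH
      hp2 (by simpa only [pow_one] using htower 1) Dt β ι hmult hadd hn hk d v hv)
    hn₁ hk₁ d₁ hne hrank

/-- **THE DOOR OF A DATUM IN GENERAL (any depth; hF-free, twist-free, system-free, McCallum-leaf-free),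
modulo two standard published inputs**: as `…_kodairaNeron` with (KN_p) replaced by the Literature fact
F1 = `Gross1991_heegnerPoint_sub_ratTorsion_mem_E0` ([GZ86, III (3.1)] in the form Gross 1991 §6 uses
it; XL, cite-only). CONDITIONAL on (γ) + F1; per-curve; BSD is not proved by it.
[cite: Kolyvagin1991MathAnn, Thm. 2.3] [cite: GrossLMS1991, Prop. 3.7 (2), Prop. 6.2 (1), §10]
[cite: GrossZagier1986, III (3.1)] [cite: McCallumLMS1991, §§2–5] -/
theorem shaCorank_eq_zero_of_kolyvaginClass_ne_zero_of_rank_le_of_datum_gross1991E0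
    (h372 : GrossLMS1991.prop37_2_frobeniusCongruence)
    (hE0 : Gross1991_heegnerPoint_sub_ratTorsion_mem_E0)
    (hcm : ¬ W.HasCM) (hK : IsImaginaryQuadratic K) (hD3 : NumberField.discr K ≠ -3)
    (hD4 : NumberField.discr K ≠ -4) (hH : SatisfiesHeegnerHypothesis (W.conductorNorm ℤ) K)
    (p : ℕ) [hp : Fact p.Prime] (hp2 : p ≠ 2)
    (htower : ∀ n : ℕ, W.HasSurjectiveModNGaloisRep (p ^ n : ℕ))
    (c : K ≃ₐ[ℚ] K) (hc : c ≠ 1) (hcc : c * c = 1)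
    {n₁ : ℕ} (hn₁ : Squarefree n₁)
    (hk₁ : ∀ q ∈ n₁.primeFactors, Zhang2014.IsKolyvaginPrime (W.conductorNorm ℤ) W K p q)
    (d₁ : KolyvaginHeegnerData Dt β ι n₁) (hne : d₁.kolyvaginClass hp.out 1 ≠ 0)
    (hrank : n₁.primeFactors.card + 1 ≤ W.mordellWeilRank) :
    W.shaCorank p = 0 ∧ W.mordellWeilRank = n₁.primeFactors.card + 1 ∧
      (W.quadraticTwist (NumberField.discr K : ℚ)).mordellWeilRank ≤ n₁.primeFactors.card ∧
      Nat.card ↥(AddSubgroup.torsionBy W.toAffine.Point ((p ^ 1 : ℕ) : ℤ)) = 1 ∧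
      W.sha ⊓ AddSubgroup.torsionBy W.galH1 ((p ^ 1 : ℕ) : ℤ) = ⊥ ∧
      Nat.card ↥(selmerGroup W ((p ^ 1 : ℕ) : ℤ)) = p ^ (n₁.primeFactors.card + 1) :=
  shaCorank_eq_zero_of_kolyvaginClass_ne_zero_of_rank_le_of_datum_of_hfin h372 hcm hK hD3 hD4 hH p hp2
    htower c hc hcc
    (fun _n hn hk d v hv ↦ kolyvaginClass_mem_selmerLocalKer_finite_one_of_gross1991E0 hE0 hcm hK hD3
      hD4 hH hp2 (by simpa only [pow_one] using htower 1) Dt β ι hn hk d v hv)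
    hn₁ hk₁ d₁ hne hrank

/-- **The rank-2 slice / depth-table row OF A DATUM on the Kodaira–Néron cell**: ONE Zhang–Kolyvagin
prime `ℓ`, ANY datum `d₁` of conductor `ℓ` with `c_1(ℓ) ≠ 0`, two independent points on `E(ℚ)`, (KN_p)
and (γ) give `corank_{ℤ_p} Ш(E/ℚ)[p^∞] = 0`, `rank E(ℚ) = 2`, `rank E^{(d_K)}(ℚ) ≤ 1`, `#E(ℚ)[p] = 1`,
`Ш(E/ℚ)[p] = 0`, `#Sel_p(E/ℚ) = p²`. CONDITIONAL on (γ) only; per-curve; BSD is not proved by it.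
[cite: Kolyvagin1991MathAnn, Thm. 2.3] [cite: GrossLMS1991, Prop. 3.7 (2)]
[cite: JetchevLauterStein2009, §3.6 (arXiv:0707.0032)] -/
theorem shaCorank_eq_zero_of_two_le_rank_of_kolyvaginClass_prime_ne_zero_of_datum_kodairaNeron
    (h372 : GrossLMS1991.prop37_2_frobeniusCongruence)
    (hcm : ¬ W.HasCM) (hK : IsImaginaryQuadratic K) (hD3 : NumberField.discr K ≠ -3)
    (hD4 : NumberField.discr K ≠ -4) (hH : SatisfiesHeegnerHypothesis (W.conductorNorm ℤ) K)
    (p : ℕ) [hp : Fact p.Prime] (hp2 : p ≠ 2)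
    (htower : ∀ n : ℕ, W.HasSurjectiveModNGaloisRep (p ^ n : ℕ))
    (c : K ≃ₐ[ℚ] K) (hc : c ≠ 1) (hcc : c * c = 1)
    (hmult : ∀ v : HeightOneSpectrum (𝓞 ℚ), W.HasMultiplicativeReductionAt v →
      ¬ p ∣ W.ordMinimalDiscriminant v)
    (hadd : ∀ v : HeightOneSpectrum (𝓞 ℚ), W.HasAdditiveReductionAt v → p ≠ 3 ∨
      (W.kodairaSymbolAt v ≠ KodairaSymbol.IV ∧ W.kodairaSymbolAt v ≠ KodairaSymbol.IVstar))
    {ℓ : ℕ} (hℓ : Zhang2014.IsKolyvaginPrime (W.conductorNorm ℤ) W K p ℓ)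
    (d₁ : KolyvaginHeegnerData Dt β ι ℓ) (hne : d₁.kolyvaginClass hp.out 1 ≠ 0)
    (h2 : 2 ≤ W.mordellWeilRank) :
    W.shaCorank p = 0 ∧ W.mordellWeilRank = 2 ∧
      (W.quadraticTwist (NumberField.discr K : ℚ)).mordellWeilRank ≤ 1 ∧
      Nat.card ↥(AddSubgroup.torsionBy W.toAffine.Point (p : ℤ)) = 1 ∧
      W.sha ⊓ AddSubgroup.torsionBy W.galH1 (p : ℤ) = ⊥ ∧
      Nat.card ↥(selmerGroup W (p : ℤ)) = p ^ 2 := by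
  have hcard : ℓ.primeFactors.card = 1 := by rw [hℓ.1.primeFactors, Finset.card_singleton]
  have h := shaCorank_eq_zero_of_kolyvaginClass_ne_zero_of_rank_le_of_datum_kodairaNeron h372 hcm hK
    hD3 hD4 hH p hp2 htower c hc hcc hmult hadd hℓ.1.prime.squarefree (fun q hq ↦ by
      rw [hℓ.1.primeFactors, Finset.mem_singleton] at hq
      exact hq ▸ hℓ) d₁ hne (by rw [hcard]; exact h2)
  rw [hcard, pow_one] at h
  exact h

/-- **The rank-2 slice / depth-table row OF A DATUM in general**, modulo (γ) + F1 = [GZ86 III (3.1)].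
CONDITIONAL on those two Literature facts; per-curve; BSD is not proved by it.
[cite: Kolyvagin1991MathAnn, Thm. 2.3] [cite: GrossLMS1991, Prop. 3.7 (2), Prop. 6.2 (1)]
[cite: GrossZagier1986, III (3.1)] [cite: JetchevLauterStein2009, §3.6 (arXiv:0707.0032)] -/
theorem shaCorank_eq_zero_of_two_le_rank_of_kolyvaginClass_prime_ne_zero_of_datum_gross1991E0
    (h372 : GrossLMS1991.prop37_2_frobeniusCongruence)
    (hE0 : Gross1991_heegnerPoint_sub_ratTorsion_mem_E0)
    (hcm : ¬ W.HasCM) (hK : IsImaginaryQuadratic K) (hD3 : NumberField.discr K ≠ -3)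
    (hD4 : NumberField.discr K ≠ -4) (hH : SatisfiesHeegnerHypothesis (W.conductorNorm ℤ) K)
    (p : ℕ) [hp : Fact p.Prime] (hp2 : p ≠ 2)
    (htower : ∀ n : ℕ, W.HasSurjectiveModNGaloisRep (p ^ n : ℕ))
    (c : K ≃ₐ[ℚ] K) (hc : c ≠ 1) (hcc : c * c = 1)
    {ℓ : ℕ} (hℓ : Zhang2014.IsKolyvaginPrime (W.conductorNorm ℤ) W K p ℓ)
    (d₁ : KolyvaginHeegnerData Dt β ι ℓ) (hne : d₁.kolyvaginClass hp.out 1 ≠ 0)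
    (h2 : 2 ≤ W.mordellWeilRank) :
    W.shaCorank p = 0 ∧ W.mordellWeilRank = 2 ∧
      (W.quadraticTwist (NumberField.discr K : ℚ)).mordellWeilRank ≤ 1 ∧
      Nat.card ↥(AddSubgroup.torsionBy W.toAffine.Point (p : ℤ)) = 1 ∧
      W.sha ⊓ AddSubgroup.torsionBy W.galH1 (p : ℤ) = ⊥ ∧
      Nat.card ↥(selmerGroup W (p : ℤ)) = p ^ 2 := by
  have hcard : ℓ.primeFactors.card = 1 := by rw [hℓ.1.primeFactors, Finset.card_singleton]
  have h := shaCorank_eq_zero_of_kolyvaginClass_ne_zero_of_rank_le_of_datum_gross1991E0 h372 hE0 hcm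
    hK hD3 hD4 hH p hp2 htower c hc hcc hℓ.1.prime.squarefree (fun q hq ↦ by
      rw [hℓ.1.primeFactors, Finset.mem_singleton] at hq
      exact hq ▸ hℓ) d₁ hne (by rw [hcard]; exact h2)
  rw [hcard, pow_one] at h
  exact h

end Datum

end Summit.BirchSwinnertonDyer.BirchSwinnertonDyer.Theorems.KolyvaginDepthDoor

end
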